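import Mathlib
import Summits.NavierStokesRegularity.NavierStokesRegularity.Theorems.EulerZoomLiouvillePowerGaugeEulerLiouvilleNeedleAxisymBand

/-!
# Needle portrait, axisymmetric case: LEMMA K IN LOG-CAPACITY FORM (ROUND-37 plate t38h)

Seat nsreg-p2 (`HOME/ns-regularity-ideate-p2/ROUND-37.md` §1 (K), v1.3); helper material for crux E
(`EulerZoomLiouville.PowerGaugeEulerLiouville`, stmt-NavierStokesRegularity-19832); one-variable real
analysis only, nothing is wired into the LEAD's skeleton.

Along a meridian `θ ∈ [0, π]` of a sphere `S_t` the inflow speed `f = −V_r` of an axisymmetric profile is `C¹`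
in the polar angle, with a weighted Dirichlet budget `∫_0^π f′² sin θ dθ ≤ D₁` and a Chebyshev budget «every
band `[a, b]` on which `f ≥ m/2` has `cos a − cos b ≤ μ`» (sphere averages of the class budgets; next plate).
For functions of the latitude the length–area argument of plates t36/t37c is the WEIGHTED Cauchy–Schwarz
inequality `(f b − f θ₀)² ≤ (∫_{θ₀}^{b} dθ/sin θ)(∫_{θ₀}^{b} f′² sin θ)` with `∫_{θ₀}^{b} dθ/sin θ ≤ (π/2) log(b/θ₀)`
(Jordan): a drop from `m` to `m/2` between latitudes `θ₀ < b ≤ π/2` forces `log(b/θ₀) ≥ Λ` whenever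
`2πD₁Λ ≤ m²`, while Chebyshev gives `b² ≤ πμ + θ₀²`.  Result `sin_le_sqrt_mul_exp_of_level`: **every
`θ₀ ∈ [0, π]` with `f θ₀ ≥ m` has `sin θ₀ ≤ √(2πμ)·e^{−Λ}`** (`μ ≤ 2/5`, `Λ ≥ 1`, `2πD₁Λ ≤ m²`); bands reaching
`[π/3, 2π/3]` are excluded outright (`false_of_level_no_dip`).  With `m = γt` and good-sphere budgets
`D₁ = O(R^{−ρ})`, `Λ ≍ γ²R^{2+ρ}`: the `γ`-fast latitudes of a needle hug the symmetry axis super-exponentially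
— Lemma K of ROUND-37 without charts, frames or good-radius selections (it supersedes the `hcap` input of
`sin_le_of_band`, plate t38a).  Namespace `…PowerGaugeEulerLiouville.NeedleAxisymBand`, new names only.
-/

open MeasureTheory Set Real intervalIntegral

set_option linter.dupNamespace false

namespace Summit.NavierStokesRegularity.NavierStokesRegularity.Theorems.PowerGaugeEulerLiouville.NeedleAxisymBand

/-- **Weighted Cauchy–Schwarz (1-D capacity).**  For `f ∈ C¹` and a weight `w` continuous and positive on
`[θ₀, θ₁]`: `(f θ₁ − f θ₀)² ≤ (∫_{θ₀}^{θ₁} w⁻¹) · ∫_{θ₀}^{θ₁} f′² w`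
(expand `0 ≤ ∫ (f′ − c w⁻¹)² w` with `c = (f θ₁ − f θ₀)/∫ w⁻¹`). -/
theorem sq_sub_le_integral_inv_mul_integral_mul {f f' w : ℝ → ℝ} (hf : ∀ θ, HasDerivAt f (f' θ) θ)
    (hf'c : Continuous f') {θ₀ θ₁ : ℝ} (h : θ₀ < θ₁) (hwc : ContinuousOn w (Icc θ₀ θ₁))
    (hwpos : ∀ θ ∈ Icc θ₀ θ₁, 0 < w θ) :
    (f θ₁ - f θ₀) ^ 2 ≤ (∫ θ in θ₀..θ₁, (w θ)⁻¹) * ∫ θ in θ₀..θ₁, f' θ ^ 2 * w θ := by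
  have hle : θ₀ ≤ θ₁ := h.le
  have hwne : ∀ θ ∈ Icc θ₀ θ₁, w θ ≠ 0 := fun θ hθ => (hwpos θ hθ).ne'
  have hwic : ContinuousOn (fun θ => (w θ)⁻¹) (Icc θ₀ θ₁) := hwc.inv₀ hwne
  have i_f' : IntervalIntegrable f' volume θ₀ θ₁ := hf'c.intervalIntegrable _ _
  have i_inv : IntervalIntegrable (fun θ => (w θ)⁻¹) volume θ₀ θ₁ := hwic.intervalIntegrable_of_Icc hle
  have i_sqw : IntervalIntegrable (fun θ => f' θ ^ 2 * w θ) volume θ₀ θ₁ :=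
    (((hf'c.pow 2).continuousOn).mul hwc).intervalIntegrable_of_Icc hle
  have hftc : ∫ θ in θ₀..θ₁, f' θ = f θ₁ - f θ₀ := integral_eq_sub_of_hasDerivAt (fun θ _ => hf θ) i_f'
  set A := ∫ θ in θ₀..θ₁, f' θ ^ 2 * w θ with hA
  set B := f θ₁ - f θ₀ with hB
  set C := ∫ θ in θ₀..θ₁, (w θ)⁻¹ with hC
  have hCpos : 0 < C := hC ▸ intervalIntegral.intervalIntegral_pos_of_pos_on i_inv
    (fun θ hθ => inv_pos.2 (hwpos θ (Ioo_subset_Icc_self hθ))) h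
  -- the quadratic form `c ↦ A - 2 c B + c² C` is nonnegative
  have key : ∀ c : ℝ, 0 ≤ A - 2 * c * B + c ^ 2 * C := by
    intro c
    have i1 : IntervalIntegrable (fun θ => (f' θ - c * (w θ)⁻¹) ^ 2 * w θ) volume θ₀ θ₁ := by
      refine ContinuousOn.intervalIntegrable_of_Icc hle ?_
      exact (((hf'c.continuousOn).sub (continuousOn_const.mul hwic)).pow 2).mul hwc
    have hnn : 0 ≤ ∫ θ in θ₀..θ₁, (f' θ - c * (w θ)⁻¹) ^ 2 * w θ :=
      intervalIntegral.integral_nonneg hle fun θ hθ => mul_nonneg (sq_nonneg _) (hwpos θ hθ).le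
    have hexp : ∫ θ in θ₀..θ₁, (f' θ - c * (w θ)⁻¹) ^ 2 * w θ =
        ∫ θ in θ₀..θ₁, (f' θ ^ 2 * w θ - (2 * c) * f' θ + c ^ 2 * (w θ)⁻¹) := by
      refine intervalIntegral.integral_congr fun θ hθ => ?_
      rw [uIcc_of_le hle] at hθ
      field_simp [hwne θ hθ]
      ring
    have hsplit : ∫ θ in θ₀..θ₁, (f' θ ^ 2 * w θ - (2 * c) * f' θ + c ^ 2 * (w θ)⁻¹) =
        A - 2 * c * B + c ^ 2 * C := by
      rw [intervalIntegral.integral_add (i_sqw.sub (i_f'.const_mul _)) (i_inv.const_mul _),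
        intervalIntegral.integral_sub i_sqw (i_f'.const_mul _), intervalIntegral.integral_const_mul,
        intervalIntegral.integral_const_mul, hftc]
    rw [hexp, hsplit] at hnn; exact hnn
  have h1 := key (B / C)
  have h2 : A - 2 * (B / C) * B + (B / C) ^ 2 * C = A - B ^ 2 / C := by field_simp; ring
  rw [h2] at h1
  have h3 : B ^ 2 / C ≤ A := by linarith
  rw [div_le_iff₀ hCpos] at h3
  linarith [h3]

/-- `∫_{θ₀}^{b} dθ / sin θ ≤ (π/2) · log (b/θ₀)` for `0 < θ₀ ≤ b ≤ π/2` (Jordan: `sin θ ≥ 2θ/π`). -/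
theorem integral_inv_sin_le {θ₀ b : ℝ} (hθ₀ : 0 < θ₀) (hθ₀b : θ₀ ≤ b) (hb : b ≤ π / 2) :
    ∫ θ in θ₀..b, (Real.sin θ)⁻¹ ≤ π / 2 * Real.log (b / θ₀) := by
  have hbpos : 0 < b := hθ₀.trans_le hθ₀b
  have hmono : ∫ θ in θ₀..b, (Real.sin θ)⁻¹ ≤ ∫ θ in θ₀..b, π / 2 * θ⁻¹ := by
    have hsinpos : ∀ θ ∈ Icc θ₀ b, 0 < Real.sin θ := fun θ hθ =>
      Real.sin_pos_of_pos_of_lt_pi (hθ₀.trans_le hθ.1) (by linarith [hθ.2, Real.pi_pos])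
    refine intervalIntegral.integral_mono_on hθ₀b ?_ ?_ fun θ hθ => ?_
    · refine ContinuousOn.intervalIntegrable_of_Icc hθ₀b ?_
      exact Real.continuous_sin.continuousOn.inv₀ fun θ hθ => (hsinpos θ hθ).ne'
    · refine ContinuousOn.intervalIntegrable_of_Icc hθ₀b ?_
      exact continuousOn_const.mul (continuousOn_inv₀.mono fun θ hθ => (hθ₀.trans_le hθ.1).ne')
    · have hθpos : 0 < θ := hθ₀.trans_le hθ.1
      have hJ : 2 / π * θ ≤ Real.sin θ := Real.mul_le_sin hθpos.le (hθ.2.trans hb)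
      have hJpos : 0 < 2 / π * θ := by positivity
      calc (Real.sin θ)⁻¹ ≤ (2 / π * θ)⁻¹ := by
            rw [inv_le_inv₀ (hsinpos θ hθ) hJpos]; exact hJ
        _ = π / 2 * θ⁻¹ := by field_simp
  calc ∫ θ in θ₀..b, (Real.sin θ)⁻¹ ≤ ∫ θ in θ₀..b, π / 2 * θ⁻¹ := hmono
    _ = π / 2 * Real.log (b / θ₀) := by
        rw [intervalIntegral.integral_const_mul, integral_inv_of_pos hθ₀ hbpos]

/-- `b² − θ₀² ≤ π · (cos θ₀ − cos b)` for `0 ≤ θ₀ ≤ b ≤ π/2` (`cos θ₀ − cos b = ∫ sin ≥ ∫ 2θ/π`). -/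
theorem sq_sub_sq_le_pi_mul {θ₀ b : ℝ} (hθ₀ : 0 ≤ θ₀) (hθ₀b : θ₀ ≤ b) (hb : b ≤ π / 2) :
    b ^ 2 - θ₀ ^ 2 ≤ π * (Real.cos θ₀ - Real.cos b) := by
  have hmono : ∫ θ in θ₀..b, 2 / π * θ ≤ ∫ θ in θ₀..b, Real.sin θ := by
    refine intervalIntegral.integral_mono_on hθ₀b ?_ ?_ fun θ hθ => ?_
    · exact (continuous_const.mul continuous_id).intervalIntegrable _ _
    · exact Real.continuous_sin.intervalIntegrable _ _
    · exact Real.mul_le_sin (hθ₀.trans hθ.1) (hθ.2.trans hb)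
  rw [integral_sin, intervalIntegral.integral_const_mul, integral_id] at hmono
  have hπ := Real.pi_pos
  have : 2 / π * ((b ^ 2 - θ₀ ^ 2) / 2) = (b ^ 2 - θ₀ ^ 2) / π := by field_simp
  rw [this, div_le_iff₀ hπ] at hmono
  linarith

/-- `e^{−2Λ} ≤ 1/2` for `Λ ≥ 1`. -/
theorem exp_neg_two_mul_le_half {Λ : ℝ} (hΛ : 1 ≤ Λ) : Real.exp (-(2 * Λ)) ≤ 1 / 2 := by
  have h3 : (3 : ℝ) ≤ Real.exp (2 * Λ) := by linarith [Real.add_one_le_exp (2 * Λ)]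
  rw [Real.exp_neg, inv_le_comm₀ (Real.exp_pos _) (by norm_num : (0 : ℝ) < 1 / 2)]
  linarith

/-- Sub-interval monotonicity of the weighted Dirichlet budget on `[0, π]`. -/
theorem integral_sq_mul_sin_le {f' : ℝ → ℝ} (hf'c : Continuous f') {D₁ : ℝ}
    (hD : ∫ θ in (0 : ℝ)..π, f' θ ^ 2 * Real.sin θ ≤ D₁) {u v : ℝ} (hu : 0 ≤ u) (huv : u ≤ v)
    (hv : v ≤ π) : ∫ θ in u..v, f' θ ^ 2 * Real.sin θ ≤ D₁ := by
  refine le_trans ?_ hD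
  refine intervalIntegral.integral_mono_interval hu huv hv ?_
    (((hf'c.pow 2).mul Real.continuous_sin).intervalIntegrable _ _)
  refine (ae_restrict_mem measurableSet_Ioc).mono fun θ hθ => ?_
  exact mul_nonneg (sq_nonneg _) (Real.sin_nonneg_of_mem_Icc ⟨hθ.1.le, hθ.2⟩)

/-- **The dip computation.**  `0 < θ₀ < b ≤ π/2`, `f θ₀ ≥ m`, `f b ≤ m/2`, the Chebyshev bound
`cos θ₀ − cos b ≤ μ` and the weighted Dirichlet budget `∫_{θ₀}^{b} f′² sin ≤ D₁` with `2πD₁Λ ≤ m²`, `Λ ≥ 1`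
force `θ₀ ≤ √(2πμ) · e^{−Λ}` (capacity `m²/4 ≤ (π/2) log(b/θ₀) · D₁`, Chebyshev `b² − θ₀² ≤ πμ`). -/
theorem le_sqrt_mul_exp_of_dip {f f' : ℝ → ℝ} (hf : ∀ θ, HasDerivAt f (f' θ) θ)
    (hf'c : Continuous f') {m D₁ μ Λ θ₀ b : ℝ} (hm : 0 < m) (hΛ : 1 ≤ Λ)
    (hΛD : 2 * π * D₁ * Λ ≤ m ^ 2) (hθpos : 0 < θ₀) (hθb : θ₀ < b) (hbπ2 : b ≤ π / 2)
    (hfθ₀ : m ≤ f θ₀) (hfb : f b ≤ m / 2) (hche : Real.cos θ₀ - Real.cos b ≤ μ)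
    (hDb : ∫ θ in θ₀..b, f' θ ^ 2 * Real.sin θ ≤ D₁) :
    θ₀ ≤ Real.sqrt (2 * π * μ) * Real.exp (-Λ) := by
  have hπ := Real.pi_pos
  have hbpos : 0 < b := hθpos.trans hθb
  -- Chebyshev: `b² - θ₀² ≤ π μ`
  have hbsq : b ^ 2 - θ₀ ^ 2 ≤ π * μ :=
    (sq_sub_sq_le_pi_mul hθpos.le hθb.le hbπ2).trans (mul_le_mul_of_nonneg_left hche hπ.le)
  -- capacity: `m²/4 ≤ (π/2) log(b/θ₀) D₁`
  have hsinpos : ∀ θ ∈ Icc θ₀ b, 0 < Real.sin θ := fun θ hθ =>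
    Real.sin_pos_of_pos_of_lt_pi (hθpos.trans_le hθ.1) (by linarith [hθ.2])
  have hCS := sq_sub_le_integral_inv_mul_integral_mul hf hf'c hθb
    Real.continuous_sin.continuousOn hsinpos
  have hdrop : (m / 2) ^ 2 ≤ (f b - f θ₀) ^ 2 := by
    rw [show (f b - f θ₀) ^ 2 = (f θ₀ - f b) ^ 2 by ring]
    exact pow_le_pow_left₀ (by linarith) (by linarith) 2
  have hinv := integral_inv_sin_le hθpos hθb.le hbπ2
  have hIw0 : 0 ≤ ∫ θ in θ₀..b, f' θ ^ 2 * Real.sin θ :=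
    intervalIntegral.integral_nonneg hθb.le fun θ hθ => mul_nonneg (sq_nonneg _) (hsinpos θ hθ).le
  have hL0 : 0 ≤ Real.log (b / θ₀) := Real.log_nonneg (by rw [le_div_iff₀ hθpos]; linarith)
  have hcap : m ^ 2 ≤ 2 * π * D₁ * Real.log (b / θ₀) := by
    have h1 : (∫ θ in θ₀..b, (Real.sin θ)⁻¹) * (∫ θ in θ₀..b, f' θ ^ 2 * Real.sin θ) ≤
        (π / 2 * Real.log (b / θ₀)) * ∫ θ in θ₀..b, f' θ ^ 2 * Real.sin θ :=
      mul_le_mul_of_nonneg_right hinv hIw0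
    have h2 : (π / 2 * Real.log (b / θ₀)) * (∫ θ in θ₀..b, f' θ ^ 2 * Real.sin θ) ≤
        (π / 2 * Real.log (b / θ₀)) * D₁ :=
      mul_le_mul_of_nonneg_left hDb (by positivity)
    have h3 : (m / 2) ^ 2 ≤ (π / 2 * Real.log (b / θ₀)) * D₁ := (hdrop.trans hCS).trans (h1.trans h2)
    linarith [show (m / 2) ^ 2 = m ^ 2 / 4 by ring]
  -- hence `0 < D₁`, `Λ ≤ log(b/θ₀)`, `θ₀ ≤ b e^{-Λ}`
  have hm2 : 0 < m ^ 2 := by positivity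
  have hD1pos : 0 < D₁ := by
    by_contra hle; push Not at hle
    have : 2 * π * D₁ * Real.log (b / θ₀) ≤ 0 :=
      mul_nonpos_of_nonpos_of_nonneg (by nlinarith) hL0
    linarith
  have hΛL : Λ ≤ Real.log (b / θ₀) :=
    le_of_mul_le_mul_left (hΛD.trans hcap) (by positivity : 0 < 2 * π * D₁)
  have hθ₀le : θ₀ ≤ b * Real.exp (-Λ) := by
    have h1 : Real.exp Λ ≤ b / θ₀ := by
      calc Real.exp Λ ≤ Real.exp (Real.log (b / θ₀)) := Real.exp_le_exp.2 hΛL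
        _ = b / θ₀ := Real.exp_log (div_pos hbpos hθpos)
    rw [le_div_iff₀ hθpos] at h1
    have h2 : θ₀ * Real.exp Λ * Real.exp (-Λ) ≤ b * Real.exp (-Λ) :=
      mul_le_mul_of_nonneg_right (by linarith) (Real.exp_pos _).le
    rwa [mul_assoc, ← Real.exp_add, add_neg_cancel, Real.exp_zero, mul_one] at h2
  -- `b² (1 - e^{-2Λ}) ≤ π μ` and `e^{-2Λ} ≤ 1/2` give `b² ≤ 2 π μ`
  have hE : Real.exp (-Λ) ^ 2 = Real.exp (-(2 * Λ)) := by rw [sq, ← Real.exp_add]; ring_nf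
  have hθ₀sq : θ₀ ^ 2 ≤ b ^ 2 * Real.exp (-(2 * Λ)) := by
    simpa only [mul_pow, hE] using pow_le_pow_left₀ hθpos.le hθ₀le 2
  have hb2 : b ^ 2 ≤ 2 * π * μ := by
    linarith [mul_le_mul_of_nonneg_left (exp_neg_two_mul_le_half hΛ) (sq_nonneg b)]
  have hμ0 : 0 ≤ μ := by nlinarith [sq_nonneg b, hb2, hπ]
  have hRHS : 0 ≤ Real.sqrt (2 * π * μ) * Real.exp (-Λ) := by positivity
  have hfin : θ₀ ^ 2 ≤ (Real.sqrt (2 * π * μ) * Real.exp (-Λ)) ^ 2 := by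
    rw [mul_pow, Real.sq_sqrt (by positivity), hE]
    exact hθ₀sq.trans (mul_le_mul_of_nonneg_right hb2 (Real.exp_pos _).le)
  have := Real.sqrt_le_sqrt hfin
  rwa [Real.sqrt_sq hθpos.le, Real.sqrt_sq hRHS] at this

/-- **No dip before the equator is impossible.**  If `f ≥ m/2` on all of `[θ₀, π/2]` (with `f θ₀ ≥ m`,
`θ₀ ≤ π/2`), the Chebyshev budget with `μ ≤ 2/5 < cos (π/3)` pushes the band into `(π/3, π/2]`, where
`sin ≥ 2/3` and the unweighted Cauchy–Schwarz bound costs `m² ≤ π D₁ < 2πD₁Λ`. -/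
theorem false_of_level_no_dip {f f' : ℝ → ℝ} (hf : ∀ θ, HasDerivAt f (f' θ) θ)
    (hf'c : Continuous f') {m D₁ μ Λ : ℝ} (hm : 0 < m) (hμ : μ ≤ 2 / 5) (hΛ : 1 ≤ Λ)
    (hΛD : 2 * π * D₁ * Λ ≤ m ^ 2)
    (hcheb : ∀ a b : ℝ, 0 ≤ a → a ≤ b → b ≤ π → (∀ θ ∈ Icc a b, m / 2 ≤ f θ) →
      Real.cos a - Real.cos b ≤ μ)
    (hD : ∫ θ in (0 : ℝ)..π, f' θ ^ 2 * Real.sin θ ≤ D₁)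
    {θ₀ : ℝ} (hθπ2 : θ₀ ≤ π / 2) (hfθ₀ : m ≤ f θ₀)
    (hallR : ∀ θ ∈ Icc θ₀ (π / 2), m / 2 ≤ f θ) : False := by
  have hπ := Real.pi_pos
  have hfc : Continuous f := continuous_iff_continuousAt.2 fun θ => (hf θ).continuousAt
  have hD0 : 0 ≤ D₁ := by simpa using integral_sq_mul_sin_le hf'c hD le_rfl le_rfl hπ.le
  -- Chebyshev on `[θ₀, π/2]`: `cos θ₀ ≤ μ ≤ 2/5 < cos (π/3)`, so `θ₀ > π/3`
  have hcos_gt : ∀ x : ℝ, 0 ≤ x → Real.cos x ≤ μ → π / 3 < x := by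
    intro x hx hcx
    by_contra hle; push Not at hle
    have : Real.cos (π / 3) ≤ Real.cos x := Real.cos_le_cos_of_nonneg_of_le_pi hx (by linarith) hle
    rw [Real.cos_pi_div_three] at this
    linarith
  obtain ⟨Ls, hLs⟩ : ∃ Ls : Set ℝ, Ls = Icc 0 θ₀ ∩ {θ | f θ ≤ m / 2} := ⟨_, rfl⟩
  have hLc : IsClosed Ls := by rw [hLs]; exact isClosed_Icc.inter (isClosed_le hfc continuous_const)
  by_cases hLne : Ls.Nonempty
  swap
  · -- `f ≥ m/2` on all of `[0, π/2]`: Chebyshev gives `1 ≤ μ`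
    have hall : ∀ θ ∈ Icc 0 (π / 2), m / 2 ≤ f θ := by
      intro θ hθ
      rcases le_total θ θ₀ with h1 | h1
      · by_contra hlt; push Not at hlt; exact hLne ⟨θ, by rw [hLs]; exact ⟨⟨hθ.1, h1⟩, hlt.le⟩⟩
      · exact hallR θ ⟨h1, hθ.2⟩
    have := hcheb 0 (π / 2) le_rfl (by linarith) (by linarith) hall
    rw [Real.cos_zero, Real.cos_pi_div_two] at this
    linarith
  have hLb : BddAbove Ls := ⟨θ₀, fun θ hθ => by rw [hLs] at hθ; exact hθ.1.2⟩
  have haL : sSup Ls ∈ Ls := hLc.csSup_mem hLne hLb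
  obtain ⟨a, ha⟩ : ∃ a : ℝ, a = sSup Ls := ⟨_, rfl⟩
  rw [← ha, hLs] at haL
  have ha0 : 0 ≤ a := haL.1.1
  have haθ : a ≤ θ₀ := haL.1.2
  have hfa : f a ≤ m / 2 := haL.2
  have haθ' : a < θ₀ := lt_of_le_of_ne haθ fun h => by rw [h] at hfa; linarith
  have hmidL : ∀ θ, a < θ → θ ≤ θ₀ → m / 2 < f θ := by
    intro θ h1 h2
    by_contra hle; push Not at hle
    have hmem : θ ∈ Ls := by rw [hLs]; exact ⟨⟨ha0.trans h1.le, h2⟩, hle⟩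
    exact absurd (ha ▸ le_csSup hLb hmem) (not_le.2 h1)
  -- by closedness `m/2 ≤ f` on `[a, θ₀]`, hence on `[a, π/2]`
  have hclosed : IsClosed {θ : ℝ | m / 2 ≤ f θ} := isClosed_le continuous_const hfc
  have hIcc : Icc a θ₀ ⊆ {θ | m / 2 ≤ f θ} := by
    rw [← closure_Ioc haθ'.ne]
    exact hclosed.closure_subset_iff.2 fun θ hθ => (hmidL θ hθ.1 hθ.2).le
  have hallA : ∀ θ ∈ Icc a (π / 2), m / 2 ≤ f θ := fun θ hθ =>
    (le_total θ θ₀).elim (fun h1 => hIcc ⟨hθ.1, h1⟩) fun h1 => hallR θ ⟨h1, hθ.2⟩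
  have hcosa : Real.cos a ≤ μ := by
    have := hcheb a (π / 2) ha0 (by linarith) (by linarith) hallA
    rwa [Real.cos_pi_div_two, sub_zero] at this
  have hagt : π / 3 < a := hcos_gt a ha0 hcosa
  -- unweighted Cauchy–Schwarz on `[a, θ₀] ⊆ [π/3, π/2]`, where `sin ≥ 2/3`
  have hCS := sq_sub_le_mul_integral_sq hf hf'c haθ'
  have hdrop : (m / 2) ^ 2 ≤ (f θ₀ - f a) ^ 2 :=
    pow_le_pow_left₀ (by linarith) (by linarith) 2
  have hwt : 2 / 3 * ∫ θ in a..θ₀, f' θ ^ 2 ≤ ∫ θ in a..θ₀, f' θ ^ 2 * Real.sin θ := by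
    rw [← intervalIntegral.integral_const_mul]
    refine intervalIntegral.integral_mono_on haθ ?_ ?_ fun θ hθ => ?_
    · exact (continuous_const.mul (hf'c.pow 2)).intervalIntegrable _ _
    · exact ((hf'c.pow 2).mul Real.continuous_sin).intervalIntegrable _ _
    · have hJ : 2 / π * θ ≤ Real.sin θ := Real.mul_le_sin (ha0.trans hθ.1) (hθ.2.trans hθπ2)
      have h23 : 2 / 3 ≤ 2 / π * θ := by
        have h1 : 2 / π * (π / 3) ≤ 2 / π * θ :=
          mul_le_mul_of_nonneg_left (by linarith [hθ.1]) (by positivity)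
        have h2 : 2 / π * (π / 3) = 2 / 3 := by field_simp
        linarith
      rw [mul_comm (f' θ ^ 2)]
      exact mul_le_mul_of_nonneg_right (h23.trans hJ) (sq_nonneg _)
  have hDa : ∫ θ in a..θ₀, f' θ ^ 2 * Real.sin θ ≤ D₁ :=
    integral_sq_mul_sin_le hf'c hD ha0 haθ (by linarith)
  have hI0 : 0 ≤ ∫ θ in a..θ₀, f' θ ^ 2 := intervalIntegral.integral_nonneg haθ fun θ _ => sq_nonneg _
  -- `m²/4 ≤ (θ₀ - a) ∫ f'^2 ≤ (π/6) (3/2) D₁`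
  have hlen : θ₀ - a ≤ π / 6 := by linarith
  have h1 : (θ₀ - a) * ∫ θ in a..θ₀, f' θ ^ 2 ≤ π / 6 * ∫ θ in a..θ₀, f' θ ^ 2 :=
    mul_le_mul_of_nonneg_right hlen hI0
  have h2 : ∫ θ in a..θ₀, f' θ ^ 2 ≤ 3 / 2 * D₁ := by linarith [hwt, hDa]
  have h3 : π / 6 * ∫ θ in a..θ₀, f' θ ^ 2 ≤ π / 6 * (3 / 2 * D₁) :=
    mul_le_mul_of_nonneg_left h2 (by positivity)
  have hm2 : m ^ 2 ≤ π * D₁ := by linarith [show (m / 2) ^ 2 = m ^ 2 / 4 by ring, hdrop, hCS, h1, h3]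
  have h4 : 2 * π * D₁ * 1 ≤ 2 * π * D₁ * Λ := mul_le_mul_of_nonneg_left hΛ (by positivity)
  have h7 : 0 < m ^ 2 := by positivity
  linarith

/-- **Lemma K, northern hemisphere.**  `f ∈ C¹`, a level `m > 0`, the weighted Dirichlet budget
`∫_0^π f′² sin ≤ D₁`, the Chebyshev budget «`f ≥ m/2` on `[a, b] ⊆ [0, π]` ⇒ `cos a − cos b ≤ μ`» with
`μ ≤ 2/5`, and `Λ ≥ 1` with `2π D₁ Λ ≤ m²`.  Then every `θ₀ ∈ [0, π/2]` with `f θ₀ ≥ m` has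
`sin θ₀ ≤ √(2πμ) · e^{−Λ}`. -/
theorem sin_le_sqrt_mul_exp_of_level_north {f f' : ℝ → ℝ} (hf : ∀ θ, HasDerivAt f (f' θ) θ)
    (hf'c : Continuous f') {m D₁ μ Λ : ℝ} (hm : 0 < m) (hμ : μ ≤ 2 / 5) (hΛ : 1 ≤ Λ)
    (hΛD : 2 * π * D₁ * Λ ≤ m ^ 2)
    (hcheb : ∀ a b : ℝ, 0 ≤ a → a ≤ b → b ≤ π → (∀ θ ∈ Icc a b, m / 2 ≤ f θ) →
      Real.cos a - Real.cos b ≤ μ)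
    (hD : ∫ θ in (0 : ℝ)..π, f' θ ^ 2 * Real.sin θ ≤ D₁)
    {θ₀ : ℝ} (hθ₀ : θ₀ ∈ Icc (0 : ℝ) (π / 2)) (hfθ₀ : m ≤ f θ₀) :
    Real.sin θ₀ ≤ Real.sqrt (2 * π * μ) * Real.exp (-Λ) := by
  have hπ := Real.pi_pos
  have hfc : Continuous f := continuous_iff_continuousAt.2 fun θ => (hf θ).continuousAt
  obtain ⟨h0θ, hθπ2⟩ := hθ₀
  have hθπ : θ₀ ≤ π := by linarith
  -- `0 ≤ μ` (the degenerate band `[θ₀, θ₀]`)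
  have hμ0 : 0 ≤ μ := by
    have := hcheb θ₀ θ₀ h0θ le_rfl hθπ fun θ hθ => by
      have : θ = θ₀ := le_antisymm hθ.2 hθ.1
      rw [this]; linarith
    simpa using this
  have hRHS : 0 ≤ Real.sqrt (2 * π * μ) * Real.exp (-Λ) := by positivity
  rcases h0θ.eq_or_lt with h00 | hθpos
  · rw [← h00, Real.sin_zero]; exact hRHS
  obtain ⟨Rs, hRs⟩ : ∃ Rs : Set ℝ, Rs = Icc θ₀ (π / 2) ∩ {θ | f θ ≤ m / 2} := ⟨_, rfl⟩
  have hRc : IsClosed Rs := by rw [hRs]; exact isClosed_Icc.inter (isClosed_le hfc continuous_const)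
  by_cases hRne : Rs.Nonempty
  swap
  · exfalso
    have hallR : ∀ θ ∈ Icc θ₀ (π / 2), m / 2 ≤ f θ := by
      intro θ hθ; by_contra hlt; push Not at hlt
      exact hRne ⟨θ, by rw [hRs]; exact ⟨hθ, hlt.le⟩⟩
    exact false_of_level_no_dip hf hf'c hm hμ hΛ hΛD hcheb hD hθπ2 hfθ₀ hallR
  have hRb : BddBelow Rs := ⟨θ₀, fun θ hθ => by rw [hRs] at hθ; exact hθ.1.1⟩
  have hbR : sInf Rs ∈ Rs := hRc.csInf_mem hRne hRb
  obtain ⟨b, hb⟩ : ∃ b : ℝ, b = sInf Rs := ⟨_, rfl⟩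
  rw [← hb, hRs] at hbR
  have hθb : θ₀ ≤ b := hbR.1.1
  have hbπ2 : b ≤ π / 2 := hbR.1.2
  have hfb : f b ≤ m / 2 := hbR.2
  have hθb' : θ₀ < b := lt_of_le_of_ne hθb fun h => by rw [← h] at hfb; linarith
  have hmid : ∀ θ, θ₀ ≤ θ → θ < b → m / 2 < f θ := by
    intro θ h1 h2
    by_contra hle; push Not at hle
    have hmem : θ ∈ Rs := by rw [hRs]; exact ⟨⟨h1, h2.le.trans hbπ2⟩, hle⟩
    exact absurd (hb ▸ csInf_le hRb hmem) (not_le.2 h2)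
  have hclosed : IsClosed {θ : ℝ | m / 2 ≤ f θ} := isClosed_le continuous_const hfc
  have hIcc : Icc θ₀ b ⊆ {θ | m / 2 ≤ f θ} := by
    rw [← closure_Ico hθb'.ne]
    exact hclosed.closure_subset_iff.2 fun θ hθ => (hmid θ hθ.1 hθ.2).le
  have hche : Real.cos θ₀ - Real.cos b ≤ μ := hcheb θ₀ b h0θ hθb (by linarith) fun θ hθ => hIcc hθ
  have hDb : ∫ θ in θ₀..b, f' θ ^ 2 * Real.sin θ ≤ D₁ :=
    integral_sq_mul_sin_le hf'c hD h0θ hθb (by linarith)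
  exact (Real.sin_le hθpos.le).trans
    (le_sqrt_mul_exp_of_dip hf hf'c hm hΛ hΛD hθpos hθb' hbπ2 hfθ₀ hfb hche hDb)

/-- **Lemma K in log-capacity form (both hemispheres).**  Hypotheses as in
`sin_le_sqrt_mul_exp_of_level_north`; conclusion for every `θ₀ ∈ [0, π]` with `f θ₀ ≥ m`:
`sin θ₀ ≤ √(2πμ) · e^{−Λ}`.  (The southern case is the northern one for `θ ↦ f (π − θ)`.)
Needle reading: on a sphere `S_t` with `m = γ t`, the distance of a `γ`-fast point to the symmetry axis
is `t sin θ₀ ≤ t √(2πμ) e^{−Λ}`. -/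
theorem sin_le_sqrt_mul_exp_of_level {f f' : ℝ → ℝ} (hf : ∀ θ, HasDerivAt f (f' θ) θ)
    (hf'c : Continuous f') {m D₁ μ Λ : ℝ} (hm : 0 < m) (hμ : μ ≤ 2 / 5) (hΛ : 1 ≤ Λ)
    (hΛD : 2 * π * D₁ * Λ ≤ m ^ 2)
    (hcheb : ∀ a b : ℝ, 0 ≤ a → a ≤ b → b ≤ π → (∀ θ ∈ Icc a b, m / 2 ≤ f θ) →
      Real.cos a - Real.cos b ≤ μ)
    (hD : ∫ θ in (0 : ℝ)..π, f' θ ^ 2 * Real.sin θ ≤ D₁)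
    {θ₀ : ℝ} (hθ₀ : θ₀ ∈ Icc (0 : ℝ) π) (hfθ₀ : m ≤ f θ₀) :
    Real.sin θ₀ ≤ Real.sqrt (2 * π * μ) * Real.exp (-Λ) := by
  obtain ⟨h0θ, hθπ⟩ := hθ₀
  by_cases hN : θ₀ ≤ π / 2
  · exact sin_le_sqrt_mul_exp_of_level_north hf hf'c hm hμ hΛ hΛD hcheb hD ⟨h0θ, hN⟩ hfθ₀
  push Not at hN
  set g : ℝ → ℝ := fun θ => f (π - θ) with hg
  set g' : ℝ → ℝ := fun θ => -f' (π - θ) with hg'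
  have hgd : ∀ θ, HasDerivAt g (g' θ) θ := by
    intro θ
    have h1 : HasDerivAt (fun x : ℝ => π - x) (-1) θ := by
      simpa using (hasDerivAt_id θ).const_sub π
    have h2 := (hf (π - θ)).comp θ h1
    rwa [show f' (π - θ) * -1 = g' θ by simp [hg']] at h2
  have hg'c : Continuous g' := (hf'c.comp (continuous_const.sub continuous_id)).neg
  have hchebg : ∀ a b : ℝ, 0 ≤ a → a ≤ b → b ≤ π → (∀ θ ∈ Icc a b, m / 2 ≤ g θ) →
      Real.cos a - Real.cos b ≤ μ := by
    intro a b ha hab hb hband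
    have hband' : ∀ θ ∈ Icc (π - b) (π - a), m / 2 ≤ f θ := by
      intro θ hθ
      simpa [hg] using hband (π - θ) ⟨by linarith [hθ.2], by linarith [hθ.1]⟩
    have := hcheb (π - b) (π - a) (by linarith) (by linarith) (by linarith) hband'
    rw [Real.cos_pi_sub, Real.cos_pi_sub] at this
    linarith
  have hDg : ∫ θ in (0 : ℝ)..π, g' θ ^ 2 * Real.sin θ ≤ D₁ := by
    have hfun : (fun θ => g' θ ^ 2 * Real.sin θ) =
        fun θ => (fun u => f' u ^ 2 * Real.sin u) (π - θ) := by
      ext θ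
      simp only [hg', neg_sq, Real.sin_pi_sub]
    rw [hfun, intervalIntegral.integral_comp_sub_left (fun u => f' u ^ 2 * Real.sin u) π]
    simpa using hD
  have hθ₀' : π - θ₀ ∈ Icc (0 : ℝ) (π / 2) := ⟨by linarith, by linarith⟩
  have hgθ₀ : m ≤ g (π - θ₀) := by simpa [hg] using hfθ₀
  have := sin_le_sqrt_mul_exp_of_level_north hgd hg'c hm hμ hΛ hΛD hchebg hDg hθ₀' hgθ₀
  rwa [Real.sin_pi_sub] at this

end Summit.NavierStokesRegularity.NavierStokesRegularity.Theorems.PowerGaugeEulerLiouville.NeedleAxisymBand
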